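import Summits.BirchSwinnertonDyer.BirchSwinnertonDyer.Theorems.GenusKolyvaginAtTwoEquivariantChebotarevAtTwoOfChebotarev
import Summits.BirchSwinnertonDyer.BirchSwinnertonDyer.Theorems.CMKolyvaginAtInertTwoConjugationTypeAtTwo
import Literature.NumberTheory.EllipticCurves.HeegnerPointsKolyvaginExceptionalSelmerProofs

/-!
# Route `GenusKolyvaginAtTwo`, LINE 6, Q5 `EquivariantChebotarevAtTwo` IN ITS OWN BINDERS, modulo
# the Čebotarev named fact and the `Γ_K`-image of `E[2]` (helper, PROVED; seat gk2-p2 g5)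

`equivariantChebotarevAtTwo_of_chebotarev_of_image` — the statement of Q5 (route decl
`EquivariantChebotarevAtTwo`; both registered stubs `stub_levelOne` / `stub_higherLevel` are its
`M = 1` / `2 ≤ M` halves) with TWO extra hypotheses inserted after the field `K`:
`E(K̄)[2]` is a simple `Γ_K`-module (`hS`) with scalar commutant (`hCe`), and the named fact
`Automorphic.chebotarev_artinRep` in front. Everything else Q5 binds is CONVERTED here to the inputs
of `setInfinite_kolyvaginPrime_two_tauStable`: a complex conjugation `c₀ ∈ Γ_ℚ` (tree
`exists_isComplexConjugation`); the free generator of `E[2^M]` over `ℤ/2^M[c₀]` from `Δ < 0` (the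
mechanism of Q1, item 24879: a `2^{M-1}`-th root of a `2`-torsion point moved by `c₀` —
`exists_twoTorsion_smul_ne_of_Δ_neg` — is independent of its conjugate, Nakayama by hand; re-proved
here route-independently); `π` is an involution (from `c² = 1` and the injectivity of `i ↦ c_i` forced by
independence); exponents `M_i ≤ M` from `2^M · H¹(K, E[2^M]) = 0`.

The binder caveat stands: `hS`/`hCe` hold iff `ρ̄_{E,2}(Γ_K) = GL₂(𝔽₂)`, i.e. `K ≠ ℚ(√Δ_E)`
(for `K = ℚ(√Δ_E)`, admitted by Q5's binders, the image is `A₃` and `End_{Γ_K} E[2] = 𝔽₄`); the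
parent crux 22137 carries `¬ IsSquare (d_K · (−|Δ|))`, which for `Δ < 0` is exactly `K ≠ ℚ(√Δ_E)` —
the pen may want to copy that binder into Q5. BSD is not proved by this; Q5 is not closed.
-/

set_option autoImplicit false
set_option linter.dupNamespace false

noncomputable section

open scoped Classical

namespace Summit.BirchSwinnertonDyer.BirchSwinnertonDyer.Theorems.GenusExact

open WeierstrassCurve NumberField IsDedekindDomain Field Finset
open Literature.NumberTheory.GaloisRepresentations Literature.NumberTheory.EllipticCurves
open Literature.NumberTheory
open Summit.BirchSwinnertonDyer.BirchSwinnertonDyer.Theorems.KolyvaginEigenTwo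
  (exists_twoTorsion_smul_ne_of_Δ_neg)

/-! ### Independence of `P, c₀P` over `ℤ/2^M` from a moved `2`-torsion point (Q1's mechanism) -/

section Algebra

variable {G A : Type*} [Group G] [AddCommGroup A] [DistribMulAction G A]

/-- In an abelian group, `a • T = (a % 2) • T` when `2 • T = 0`. [folklore] -/
theorem zsmul_eq_emod_two_zsmul {T : A} (h2 : (2 : ℤ) • T = 0) (a : ℤ) : a • T = (a % 2) • T := by
  conv_lhs => rw [← Int.emod_add_mul_ediv a 2]
  rw [add_smul, mul_comm, mul_smul, h2, smul_zero, add_zero]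

/-- `𝔽₂`-independence of `T` and `gT`: if `2T = 0` and `g • T ≠ T` then `a • T + b • (g • T) = 0`
forces `a`, `b` even. [folklore] -/
theorem two_dvd_of_zsmul_add_zsmul_smul_eq_zero {g : G} {T : A} (h2 : (2 : ℤ) • T = 0)
    (hT : g • T ≠ T) {a b : ℤ} (hab : a • T + b • (g • T) = 0) : (2 : ℤ) ∣ a ∧ (2 : ℤ) ∣ b := by
  have hT0 : T ≠ 0 := fun h => hT (by rw [h, smul_zero])
  have hgT0 : g • T ≠ 0 := fun h => hT0 (by
    have h' := congrArg (fun x : A => g⁻¹ • x) h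
    simpa only [inv_smul_smul, smul_zero] using h')
  have h2g : (2 : ℤ) • (g • T) = 0 := by rw [smul_comm, h2, smul_zero]
  have hsum : T + g • T ≠ 0 := fun h => hT (by
    have h' : g • T = -T := eq_neg_of_add_eq_zero_right h
    rw [h', neg_eq_iff_add_eq_zero, ← two_zsmul, h2])
  rw [zsmul_eq_emod_two_zsmul h2 a, zsmul_eq_emod_two_zsmul h2g b] at hab
  rcases Int.emod_two_eq_zero_or_one a with ha | ha <;>
    rcases Int.emod_two_eq_zero_or_one b with hb | hb
  · exact ⟨Int.dvd_of_emod_eq_zero ha, Int.dvd_of_emod_eq_zero hb⟩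
  · rw [ha, hb, zero_smul, one_smul, zero_add] at hab
    exact absurd hab hgT0
  · rw [ha, hb, one_smul, zero_smul, add_zero] at hab
    exact absurd hab hT0
  · rw [ha, hb, one_smul, one_smul] at hab
    exact absurd hab hsum

/-- Nakayama by hand: with `T` as above, `2^M P = 0` and `2^{M-1} P = T` make `P, gP`
`ℤ/2^M`-independent. [folklore] -/
theorem pow_dvd_of_zsmul_add_zsmul_smul_eq_zero {g : G} {T : A} (h2 : (2 : ℤ) • T = 0)
    (hT : g • T ≠ T) :
    ∀ (M : ℕ) (P : A), (2 : ℤ) ^ M • P = 0 → (2 : ℤ) ^ (M - 1) • P = T →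
      ∀ a b : ℤ, a • P + b • (g • P) = 0 → (2 : ℤ) ^ M ∣ a ∧ (2 : ℤ) ^ M ∣ b := by
  intro M
  induction M with
  | zero =>
    intro P _ _ a b _
    exact ⟨by simp, by simp⟩
  | succ M ih =>
    intro P hP hPT a b hab
    rw [Nat.add_sub_cancel] at hPT
    have habT : a • T + b • (g • T) = 0 := by
      have h' := congrArg (fun x : A => (2 : ℤ) ^ M • x) hab
      simp only [smul_add, smul_zero] at h'
      rwa [smul_comm ((2 : ℤ) ^ M) a P, smul_comm ((2 : ℤ) ^ M) b (g • P),
        smul_comm ((2 : ℤ) ^ M) g P, hPT] at h'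
    obtain ⟨⟨a₁, rfl⟩, ⟨b₁, rfl⟩⟩ := two_dvd_of_zsmul_add_zsmul_smul_eq_zero h2 hT habT
    rcases Nat.eq_zero_or_pos M with hM | hM
    · subst hM
      exact ⟨by simp, by simp⟩
    · have hP2 : (2 : ℤ) ^ M • ((2 : ℤ) • P) = 0 := by rw [smul_smul, ← pow_succ, hP]
      have hP2T : (2 : ℤ) ^ (M - 1) • ((2 : ℤ) • P) = T := by
        rw [smul_smul, ← pow_succ, Nat.sub_add_cancel hM, hPT]
      have hab₁ : a₁ • ((2 : ℤ) • P) + b₁ • (g • ((2 : ℤ) • P)) = 0 := by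
        rw [← smul_comm (2 : ℤ) g P, smul_smul, smul_smul, mul_comm a₁ 2, mul_comm b₁ 2]
        exact hab
      obtain ⟨ha, hb⟩ := ih ((2 : ℤ) • P) hP2 hP2T a₁ b₁ hab₁
      exact ⟨by rw [pow_succ']; exact mul_dvd_mul_left 2 ha,
        by rw [pow_succ']; exact mul_dvd_mul_left 2 hb⟩

end Algebra

set_option maxHeartbeats 800000 in
/-- **Q5 `EquivariantChebotarevAtTwo` modulo Čebotarev and the image of `Γ_K` on `E[2]`.** The
binders are those of the route decl `Theses.GenusKolyvaginAtTwo.EquivariantChebotarevAtTwo`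
verbatim, with `(hC : Automorphic.chebotarev_artinRep)` in front and, after `K`, the two image
hypotheses `hS` (`E(K̄)[2]` has no proper non-zero `Γ_K`-stable subgroup) and `hCe` (every
`Γ_K`-equivariant endomorphism of `E(K̄)[2]` is a scalar). [cite: McCallumLMS1991, §3 Cor. 3.2]
[cite: GrossLMS1991, §9] [cite: WZhang2014, Notations (xii)] -/
theorem equivariantChebotarevAtTwo_of_chebotarev_of_image (hC : Automorphic.chebotarev_artinRep)
    (N : ℕ) [NeZero N] (W : WeierstrassCurve ℚ) [W.IsElliptic] [W.IsGloballyMinimal]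
    (_hcm : ¬ W.HasCM) (hΔ : W.Δ < 0) (K : Type) [Field K] [NumberField K]
    (hK : IsImaginaryQuadratic K)
    (hS : ∀ H : AddSubgroup (geomTorsion (W.baseChange K) 2),
      (∀ g : absoluteGaloisGroup K, ∀ t ∈ H, g • t ∈ H) → H = ⊥ ∨ H = ⊤)
    (hCe : ∀ f : geomTorsion (W.baseChange K) 2 →+ geomTorsion (W.baseChange K) 2,
      (∀ (g : absoluteGaloisGroup K) (t : geomTorsion (W.baseChange K) 2), f (g • t) = g • f t) →
        ∃ k : ℤ, ∀ t, f t = k • t)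
    (_hρ : ∀ n : ℕ, W.HasSurjectiveModNGaloisRep (2 ^ n : ℕ)) (c : K ≃ₐ[ℚ] K) (hc : c ≠ 1)
    (M : ℕ) (hM : 1 ≤ M) (r : ℕ) (cs : Fin r → galH1Torsion (W.baseChange K) ((2 ^ M : ℕ) : ℤ))
    (π : Fin r → Fin r) (h0 : ∀ i, cs i ≠ 0)
    (hτs : ∀ i, conjAct W c ((2 ^ M : ℕ) : ℤ) (cs i) = cs (π i))
    (hind : ∀ a : Fin r → ℤ, ∑ i, a i • cs i = 0 → ∀ i, (addOrderOf (cs i) : ℤ) ∣ a i)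
    (hres : ∀ a : Fin r → ℤ, (∀ ρ ∈ torsionFixing (W.baseChange K) ((2 ^ M : ℕ) : ℤ),
      h1Eval (W.baseChange K) ((2 ^ M : ℕ) : ℤ) (∑ i, a i • cs i) ρ = 0) → ∑ i, a i • cs i = 0)
    (Mi : Fin r → ℕ) (hMi : ∀ i, addOrderOf (cs i) = 2 ^ Mi i) (Nv : Fin r → ℕ)
    (hNe : ∀ i, Nv i ≤ Mi i) (hNπ : ∀ i, Nv (π i) = Nv i) :
    Set.Infinite {ℓ : ℕ | FrobEqFrobInfty W K (2 ^ M) ℓ ∧ Zhang2014.IsKolyvaginPrime N W K 2 ℓ ∧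
      M ≤ Zhang2014.kolyvaginIndex W 2 ℓ ∧
      ∀ i, ∀ v : HeightOneSpectrum (𝓞 K), (ℓ : 𝓞 K) ∈ v.asIdeal → ∀ j : ℕ,
        ((2 ^ j : ℕ) : ℤ) • cs i ∈
            (W.baseChange K).torsionLocalKer (v.adicCompletion K) ((2 ^ M : ℕ) : ℤ) ↔ Nv i ≤ j} := by
  -- ### a complex conjugation and the free generator of `E[2^M]` (Q1 on `Δ < 0`)
  obtain ⟨c₀, hc₀⟩ := exists_isComplexConjugation (Rat.castHom ℝ)
  obtain ⟨v, hv⟩ := exists_twoTorsion_smul_ne_of_Δ_neg W hΔ hc₀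
  have hv2 : (2 : ℤ) • (v : geomPoints W) = 0 := (mem_geomTorsion_iff W 2 (v : geomPoints W)).mp v.2
  have hcv : c₀ • (v : geomPoints W) ≠ (v : geomPoints W) := fun h ↦ hv (Subtype.ext h)
  have hq0 : (((2 ^ (M - 1) : ℕ) : ℤ)) ≠ 0 := by positivity
  obtain ⟨P, hP⟩ := W.zsmul_geomPoints_surjective_of_charZero hq0 (v : geomPoints W)
  have hPv : ((2 ^ (M - 1) : ℕ) : ℤ) • P = (v : geomPoints W) := hP
  have hPM : P ∈ geomTorsion W ((2 ^ M : ℕ) : ℤ) := by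
    rw [mem_geomTorsion_iff]
    have h2M : ((2 ^ M : ℕ) : ℤ) = 2 * ((2 ^ (M - 1) : ℕ) : ℤ) := by
      push_cast
      rw [← pow_succ', Nat.sub_add_cancel hM]
    rw [h2M, mul_smul, hPv, hv2]
  set P₀ : geomTorsion W ((2 ^ M : ℕ) : ℤ) := ⟨P, hPM⟩ with hP₀
  have hfree₀ : ∀ a b : ℤ, a • P₀ + b • (c₀ • P₀) = 0 → (2 : ℤ) ^ M ∣ a ∧ (2 : ℤ) ^ M ∣ b := by
    intro a b hab
    have hab' : a • P + b • (c₀ • P) = 0 := congrArg Subtype.val hab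
    have hPM' : (2 : ℤ) ^ M • P = 0 := by
      have h := (mem_geomTorsion_iff W _ P).mp hPM
      push_cast at h
      exact h
    have hPv' : (2 : ℤ) ^ (M - 1) • P = (v : geomPoints W) := by
      have h := hPv
      push_cast at h
      exact h
    exact pow_dvd_of_zsmul_add_zsmul_smul_eq_zero hv2 hcv M P hPM' hPv' a b hab'
  -- ### `π` is an involution
  have hcc : c * c = 1 := mul_self_eq_one_of_isImaginaryQuadratic hK c
  have hinj : Function.Injective cs := by
    intro i j hij
    by_contra hne
    set a : Fin r → ℤ := Pi.single i 1 - Pi.single j 1 with ha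
    have hai : a i = 1 := by
      rw [ha, Pi.sub_apply, Pi.single_eq_same, Pi.single_eq_of_ne hne, sub_zero]
    have hterm : ∀ k, a k • cs k =
        (Pi.single i 1 : Fin r → ℤ) k • cs k - (Pi.single j 1 : Fin r → ℤ) k • cs k :=
      fun k ↦ by rw [ha, Pi.sub_apply, sub_zsmul, sub_eq_add_neg]
    have hsi : ∑ k, (Pi.single i 1 : Fin r → ℤ) k • cs k = cs i := by
      rw [Finset.sum_eq_single i (fun k _ hk ↦ by rw [Pi.single_eq_of_ne hk, zero_zsmul])
        (fun h ↦ absurd (Finset.mem_univ i) h), Pi.single_eq_same, one_zsmul]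
    have hsj : ∑ k, (Pi.single j 1 : Fin r → ℤ) k • cs k = cs j := by
      rw [Finset.sum_eq_single j (fun k _ hk ↦ by rw [Pi.single_eq_of_ne hk, zero_zsmul])
        (fun h ↦ absurd (Finset.mem_univ j) h), Pi.single_eq_same, one_zsmul]
    have hsum : ∑ k, a k • cs k = 0 := by
      rw [Finset.sum_congr rfl fun k _ ↦ hterm k, Finset.sum_sub_distrib, hsi, hsj, hij, sub_self]
    have hdvd := hind a hsum i
    rw [hai] at hdvd
    have h1 : addOrderOf (cs i) = 1 := by
      have := Int.eq_one_of_dvd_one (by positivity) hdvd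
      exact_mod_cast this
    exact h0 i (AddMonoid.addOrderOf_eq_one_iff.mp h1)
  have hπ : ∀ i, π (π i) = i := fun i ↦ by
    apply hinj
    rw [← hτs, ← hτs, conjAct_conjAct_of_mul_self W hcc]
  -- ### exponents
  have hex : ∀ i, ((2 : ℤ) ^ Mi i) • cs i = 0 := fun i ↦ by
    have h := addOrderOf_nsmul_eq_zero (cs i)
    rw [hMi i, ← natCast_zsmul] at h
    exact_mod_cast h
  have hexM : ∀ i, Mi i ≤ M := fun i ↦ by
    have hkill : ((2 ^ M : ℕ) : ℤ) • cs i = 0 := zsmul_galH1Torsion_eq_zero _ _ (cs i)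
    have hdvd : addOrderOf (cs i) ∣ 2 ^ M := by
      apply addOrderOf_dvd_of_nsmul_eq_zero
      rw [← natCast_zsmul]; exact hkill
    rw [hMi i] at hdvd
    exact (Nat.pow_dvd_pow_iff_le_right (by norm_num)).mp hdvd
  have hind' : ∀ a : Fin r → ℤ, ∑ i, a i • cs i = 0 → ∀ i, ((2 : ℤ) ^ Mi i) ∣ a i := by
    intro a ha i
    have h := hind a ha i
    rw [hMi i] at h
    exact_mod_cast h
  exact setInfinite_kolyvaginPrime_two_tauStable (N := N) hC hK hM hS hCe hc₀ hfree₀ hc cs hπ hτs Mi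
    hex hexM hind' hres Nv hNe hNπ

end Summit.BirchSwinnertonDyer.BirchSwinnertonDyer.Theorems.GenusExact

end
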